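import Mathlib
import Summits.KontsevichZagierPeriods.Zeta5Search.Families.GapGaugeCyclic
import Summits.KontsevichZagierPeriods.Zeta5Search.Families.VIMGaugeInvariance
import Summits.KontsevichZagierPeriods.Zeta5Search.Families.SeatingGapGrowth
import HarnessLib

/-!
# ζ(5) search — Families: cert-2's seating gap constant terms `gapCT τ n` do not depend on which label sits at infinity

HONEST FRAMING: systematic search; no irrationality claim unless certified.  Cell `pub-zeta5`, seat P2 g10 (Families
layer), 2026-08-23.  Identities between integers (coefficients of integer polynomials); nothing about any zeta value; no
record moves; no conjecture node is used.

`Families/SeatingGapGrowth` (cert-2 g11) reads a seating `τ : Fin (ℓ+3) → Fin (ℓ+3)` as the polygon `τδ⁰` drawn on the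
points `0 < 1 < ⋯ < ℓ+1` of a line with the LABEL `ℓ+2` at infinity, and defines the diagonal gap constant term
`gapCT τ n = [X^{n·𝟙}] ∏_{finite edges e} (Σ_{w ∈ span e} X_w)ⁿ`; the census leading coefficients of all `N = 8` classes are
such `gapCT`'s (`Families/CubicalChartLead*`).  This file identifies `gapCT τ n` with the gauge-`(ℓ+2)` constant term of the
CYCLIC configuration "points `ℤ/(ℓ+3)`, chords = edges of `τδ⁰` with multiplicity `n`, sides with multiplicity `n`"
(`gapPoly_eq_endProd`, via `GapRegime.endProd`) and deduces from the gauge independence `GapRegime.gaugeCT_eq_gauge_zero`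
(`Families/GapGaugeCyclic`):
* **`SeatingGap.gapCT_add_const`**: `gapCT (τ + c) n = gapCT τ n` for every bijective seating `τ` and every label rotation
  `c` — relabelling which point is at infinity does not change the census leading coefficients (the integer-level
  counterpart of P2 g4's `fSup_add_nsmul` for growth constants).
Standard axioms only.
-/

namespace Summit.KontsevichZagierPeriods.Zeta5Search.Families.Cellular

namespace SeatingGap

open MvPolynomial Finset GapRegime

variable {ℓ : ℕ} (τ : Fin (ℓ + 3) → Fin (ℓ + 3))

/-! ## The cyclic chord datum of a seating -/

/-- Chord multiplicity of the pair of points `{x, y}`: `n ·` (number of edges `{τ e, τ (e+1)}` of the polygon `τδ⁰` equal to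
`{x, y}`). -/
def chordMult (n : ℕ) (x y : Fin (ℓ + 3)) : ℕ :=
  n * (univ.filter fun e : Fin (ℓ + 3) => (τ e = x ∧ τ (e + 1) = y) ∨ (τ e = y ∧ τ (e + 1) = x)).card

/-- `chordMult` is symmetric. -/
theorem chordMult_symm (n : ℕ) (x y : Fin (ℓ + 3)) : chordMult τ n x y = chordMult τ n y x := by
  unfold chordMult
  congr 2
  ext e
  simp only [mem_filter, mem_univ, true_and]
  exact or_comm

/-- Chord multiplicities of a label-rotated seating. -/
theorem chordMult_add_const (n : ℕ) (c x y : Fin (ℓ + 3)) :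
    chordMult (fun i => τ i + c) n x y = chordMult τ n (x - c) (y - c) := by
  unfold chordMult
  congr 2
  ext e
  simp only [mem_filter, mem_univ, true_and]
  constructor
  · rintro (⟨h1, h2⟩ | ⟨h1, h2⟩)
    · left; constructor <;> [rw [← h1]; rw [← h2]] <;> simp
    · right; constructor <;> [rw [← h1]; rw [← h2]] <;> simp
  · rintro (⟨h1, h2⟩ | ⟨h1, h2⟩)
    · left; constructor <;> [rw [h1]; rw [h2]] <;> simp
    · right; constructor <;> [rw [h1]; rw [h2]] <;> simp

/-! ## The bridge: `gapPoly τ n` is a span product `endProd` over the pairs of finite points -/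

/-- The finite edges of `τδ⁰` (neither endpoint is the label `ℓ + 2 = ∞`). -/
def finEdges : Finset (Fin (ℓ + 3)) :=
  univ.filter fun e => (τ e).val ≠ ℓ + 2 ∧ (τ (e + 1)).val ≠ ℓ + 2

/-- The endpoint pair `(min, max)` of an edge, as natural numbers. -/
def ePair (e : Fin (ℓ + 3)) : ℕ × ℕ := (min (τ e).val (τ (e + 1)).val, max (τ e).val (τ (e + 1)).val)

/-- The number of finite edges with endpoint pair `(i, j)`. -/
def pairCount (i j : ℕ) : ℕ := ((finEdges τ).filter fun e => ePair τ e = (i, j)).card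

/-- cert-2's span of an edge is `GapRegime.spanPoly` of its endpoint pair. -/
theorem spanPoly_edgeSpan (e : Fin (ℓ + 3)) :
    SpanHall.spanPoly (edgeSpan τ) e = GapRegime.spanPoly ℓ (ePair τ e).1 (ePair τ e).2 := by
  unfold SpanHall.spanPoly edgeSpan GapRegime.spanPoly ePair
  rw [Finset.sum_filter]

/-- `gapPoly τ n` as a product over the finite edges. -/
theorem gapPoly_eq_prod_finEdges (n : ℕ) :
    gapPoly τ n = ∏ e ∈ finEdges τ, GapRegime.spanPoly ℓ (ePair τ e).1 (ePair τ e).2 ^ n := by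
  unfold gapPoly SpanHall.spanProd finEdges
  rw [Finset.prod_filter]
  refine Finset.prod_congr rfl fun e _ => ?_
  unfold finExp
  split_ifs with h
  · rw [spanPoly_edgeSpan]
  · rw [pow_zero]

/-- An edge of an injective seating has two distinct endpoints: its pair is increasing. -/
theorem ePair_lt (hτ : Function.Injective τ) (e : Fin (ℓ + 3)) : (ePair τ e).1 < (ePair τ e).2 := by
  unfold ePair
  have hne : (τ e).val ≠ (τ (e + 1)).val := by
    intro h
    have := hτ (Fin.ext h)
    have h1 : (1 : Fin (ℓ + 3)) ≠ 0 := by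
      intro h0; have := congrArg Fin.val h0; simp at this
    exact h1 (by simpa using this.symm)
  simp only
  omega

/-- **The bridge**: `gapPoly τ n = endProd ℓ (n · pairCount τ)` for an injective seating. -/
theorem gapPoly_eq_endProd (hτ : Function.Injective τ) (n : ℕ) :
    gapPoly τ n = GapRegime.endProd ℓ fun i j => n * pairCount τ i j := by
  rw [gapPoly_eq_prod_finEdges]
  have hmaps : ∀ e ∈ finEdges τ, ePair τ e ∈ range (ℓ + 2) ×ˢ range (ℓ + 2) := by
    intro e he
    unfold finEdges at he
    rw [mem_filter] at he
    have h1 := (τ e).isLt; have h2 := (τ (e + 1)).isLt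
    simp only [ePair, mem_product, mem_range]
    omega
  rw [← Finset.prod_fiberwise_of_maps_to' hmaps (fun p => GapRegime.spanPoly ℓ p.1 p.2 ^ n), Finset.prod_product]
  unfold GapRegime.endProd
  refine Finset.prod_congr rfl fun i _ => Finset.prod_congr rfl fun j _ => ?_
  rw [Finset.prod_const, ← pow_mul]
  show GapRegime.spanPoly ℓ i j ^ (n * pairCount τ i j) = _
  by_cases hij : i < j
  · rw [if_pos hij]
  · rw [if_neg hij]
    have h0 : pairCount τ i j = 0 := by
      unfold pairCount
      rw [Finset.card_eq_zero, Finset.filter_eq_empty_iff]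
      intro e _ he
      have := ePair_lt τ hτ e
      rw [he] at this
      exact hij this
    rw [h0, mul_zero, pow_zero]

/-- The pair count is the chord multiplicity of the cyclic datum (finite labels `i < j < ℓ + 2`). -/
theorem pairCount_eq_chordMult (n : ℕ) (i j : ℕ) (hi : i < ℓ + 2) (hj : j < ℓ + 2) (hij : i < j) :
    n * pairCount τ i j = chordMult τ n (⟨i, by omega⟩ : Fin (ℓ + 3)) ⟨j, by omega⟩ := by
  unfold pairCount chordMult finEdges
  congr 2
  ext e
  simp only [mem_filter, mem_univ, true_and, ePair, Prod.mk.injEq, Fin.ext_iff]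
  constructor
  · rintro ⟨-, h1, h2⟩; omega
  · rintro (⟨h1, h2⟩ | ⟨h1, h2⟩) <;> refine ⟨⟨?_, ?_⟩, ?_, ?_⟩ <;> omega

/-- `gapCT τ n` is the gauge-`(ℓ+2)` constant term of the cyclic datum (labels via `Fin.ofNat`, as in
`GapRegime.gaugeCT_eq_gauge_zero` with `r = ℓ + 2`). -/
theorem gapCT_eq_gauge (hτ : Function.Injective τ) (n : ℕ) :
    gapCT τ n = coeff (gapVec ℓ fun t => (fun _ : Fin (ℓ + 3) => n) (Fin.ofNat (ℓ + 3) (ℓ + 2 + 1 + t)))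
      (GapRegime.endProd ℓ fun i j =>
        chordMult τ n (Fin.ofNat (ℓ + 3) (ℓ + 2 + 1 + i)) (Fin.ofNat (ℓ + 3) (ℓ + 2 + 1 + j))) := by
  unfold gapCT
  rw [gapPoly_eq_endProd τ hτ n]
  have hg : (n • ones (ℓ + 1)) = gapVec ℓ fun t => (fun _ : Fin (ℓ + 3) => n) (Fin.ofNat (ℓ + 3) (ℓ + 2 + 1 + t)) := by
    ext t; simp [ones, gapVec]
  rw [hg]
  congr 1
  refine VIMGauge.endProd_congr _ _ fun i j hi hj hij => ?_
  rw [pairCount_eq_chordMult τ n i j hi hj hij]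
  congr 1
  · ext; rw [Fin.val_ofNat, show ℓ + 2 + 1 + i = i + 1 * (ℓ + 3) by ring, Nat.add_mul_mod_self_right,
      Nat.mod_eq_of_lt (by omega)]
  · ext; rw [Fin.val_ofNat, show ℓ + 2 + 1 + j = j + 1 * (ℓ + 3) by ring, Nat.add_mul_mod_self_right,
      Nat.mod_eq_of_lt (by omega)]


/-! ## Balance of the cyclic datum: every point of the polygon `τδ⁰` lies on exactly two edges -/

/-- For a bijective seating, exactly one position carries a given label. -/
theorem card_filter_eq_one (hτ : Function.Bijective τ) (x : Fin (ℓ + 3)) :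
    (univ.filter fun e : Fin (ℓ + 3) => τ e = x).card = 1 := by
  obtain ⟨e₀, he₀⟩ := hτ.2 x
  rw [Finset.card_eq_one]
  refine ⟨e₀, ?_⟩
  ext e
  simp only [mem_filter, mem_univ, true_and, mem_singleton]
  constructor
  · intro h; exact hτ.1 (h.trans he₀.symm)
  · intro h; rw [h, he₀]

/-- The same for the successor position. -/
theorem card_filter_succ_eq_one (hτ : Function.Bijective τ) (x : Fin (ℓ + 3)) :
    (univ.filter fun e : Fin (ℓ + 3) => τ (e + 1) = x).card = 1 := by
  obtain ⟨e₀, he₀⟩ := hτ.2 x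
  rw [Finset.card_eq_one]
  refine ⟨e₀ - 1, ?_⟩
  ext e
  simp only [mem_filter, mem_univ, true_and, mem_singleton]
  constructor
  · intro h
    have := hτ.1 (h.trans he₀.symm)
    rw [← this]; simp
  · intro h; rw [h, sub_add_cancel, he₀]

/-- **Balance**: `Σ_{y ≠ x} chordMult τ n x y = n + n` for a bijective seating (the two edges of `τδ⁰` at `x`). -/
theorem chordMult_balanced (hτ : Function.Bijective τ) (n : ℕ) (x : Fin (ℓ + 3)) :
    (∑ y : Fin (ℓ + 3), if y = x then 0 else chordMult τ n x y) = n + n := by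
  classical
  -- consecutive positions carry different labels
  have hsucc : ∀ e : Fin (ℓ + 3), τ e ≠ τ (e + 1) := by
    intro e h
    have := hτ.1 h
    have h1 : (1 : Fin (ℓ + 3)) ≠ 0 := by
      intro h0; have := congrArg Fin.val h0; simp at this
    exact h1 (by simpa using this.symm)
  -- the edges at `x`, sorted by their other endpoint
  set S : Finset (Fin (ℓ + 3)) := univ.filter fun e => τ e = x ∨ τ (e + 1) = x with hS
  let other : Fin (ℓ + 3) → Fin (ℓ + 3) := fun e => if τ e = x then τ (e + 1) else τ e
  have hother : ∀ e ∈ S, other e ∈ univ.erase x := by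
    intro e he
    rw [hS, mem_filter] at he
    simp only [mem_erase, mem_univ, and_true, other]
    split_ifs with h
    · rw [← h]; exact (hsucc e).symm
    · rcases he.2 with h' | h'
      · exact absurd h' h
      · exact h
  have hfib : ∀ y, y ≠ x → (S.filter fun e => other e = y) =
      univ.filter fun e => (τ e = x ∧ τ (e + 1) = y) ∨ (τ e = y ∧ τ (e + 1) = x) := by
    intro y hy
    ext e
    simp only [hS, mem_filter, mem_univ, true_and, other]
    constructor
    · rintro ⟨h1, h2⟩
      split_ifs at h2 with h
      · exact Or.inl ⟨h, h2⟩
      · rcases h1 with h1 | h1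
        · exact absurd h1 h
        · exact Or.inr ⟨h2, h1⟩
    · rintro (⟨h1, h2⟩ | ⟨h1, h2⟩)
      · exact ⟨Or.inl h1, by rw [if_pos h1, h2]⟩
      · refine ⟨Or.inr h2, ?_⟩
        rw [if_neg (by rw [h1]; exact hy), h1]
  -- the sum over `y ≠ x` counts `S`
  have hsum : (∑ y : Fin (ℓ + 3), if y = x then 0 else chordMult τ n x y) =
      n * ∑ y ∈ univ.erase x, (S.filter fun e => other e = y).card := by
    rw [Finset.mul_sum, ← Finset.add_sum_erase _ _ (mem_univ x), if_pos rfl, zero_add]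
    refine Finset.sum_congr rfl fun y hy => ?_
    have hyx : y ≠ x := (mem_erase.1 hy).1
    rw [if_neg hyx, chordMult, hfib y hyx]
  rw [hsum, ← Finset.card_eq_sum_card_fiberwise hother]
  -- `S` is the disjoint union of the positions of `x` and of their predecessors
  have hS' : S = (univ.filter fun e : Fin (ℓ + 3) => τ e = x) ∪ univ.filter fun e => τ (e + 1) = x := by
    rw [hS, Finset.filter_or]
  have hdisj : Disjoint (univ.filter fun e : Fin (ℓ + 3) => τ e = x) (univ.filter fun e => τ (e + 1) = x) := by
    rw [Finset.disjoint_filter]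
    intro e _ h1 h2
    exact hsucc e (h1.trans h2.symm)
  rw [hS', Finset.card_union_of_disjoint hdisj, card_filter_eq_one τ hτ, card_filter_succ_eq_one τ hτ]
  ring

/-! ## Label rotation does not change the census leading coefficients -/

/-- **`gapCT (τ + c) n = gapCT τ n`** for a bijective seating: relabelling which point is at infinity (a rotation of the labels)
leaves the diagonal gap constant term unchanged — gauge independence `GapRegime.gaugeCT_eq_gauge_zero` for the cyclic datum of
`τ` (gauges `ℓ + 2` and `ℓ + 2 − c`). -/
theorem gapCT_add_const (hτ : Function.Bijective τ) (c : Fin (ℓ + 3)) (n : ℕ) :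
    gapCT (fun i => τ i + c) n = gapCT τ n := by
  have hτ' : Function.Bijective fun i => τ i + c := (Equiv.addRight c).bijective.comp hτ
  rw [gapCT_eq_gauge _ hτ'.1, gapCT_eq_gauge τ hτ.1]
  -- the rotated datum is the datum of `τ` read from the gauge `r = ℓ + 2 + (ℓ + 3) − c`
  set r : ℕ := ℓ + 2 + (ℓ + 3 - c.val) with hr
  have hlab : ∀ i : ℕ, Fin.ofNat (ℓ + 3) (ℓ + 2 + 1 + i) - c = Fin.ofNat (ℓ + 3) (r + 1 + i) := by
    intro i
    rw [hr, sub_eq_iff_eq_add]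
    ext
    simp only [Fin.val_ofNat, Fin.val_add]
    have hc := c.isLt
    rw [Nat.mod_add_mod, show ℓ + 2 + (ℓ + 3 - c.val) + 1 + i + c.val = (ℓ + 2 + 1 + i) + (ℓ + 3) by omega,
      Nat.add_mod_right]
  have hA : (GapRegime.endProd ℓ fun i j => chordMult (fun k => τ k + c) n (Fin.ofNat (ℓ + 3) (ℓ + 2 + 1 + i))
      (Fin.ofNat (ℓ + 3) (ℓ + 2 + 1 + j))) =
      GapRegime.endProd ℓ fun i j => chordMult τ n (Fin.ofNat (ℓ + 3) (r + 1 + i)) (Fin.ofNat (ℓ + 3) (r + 1 + j)) :=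
    endProd_congr_all fun i j => by rw [chordMult_add_const, hlab, hlab]
  have hB : (gapVec ℓ fun t => (fun _ : Fin (ℓ + 3) => n) (Fin.ofNat (ℓ + 3) (ℓ + 2 + 1 + t))) =
      gapVec ℓ fun t => (fun _ : Fin (ℓ + 3) => n) (Fin.ofNat (ℓ + 3) (r + 1 + t)) := rfl
  rw [hA, hB, gaugeCT_eq_gauge_zero (M := ℓ) (chordMult τ n) (fun _ => n) (chordMult_symm τ n)
      (chordMult_balanced τ hτ n) r,
    gaugeCT_eq_gauge_zero (M := ℓ) (chordMult τ n) (fun _ => n) (chordMult_symm τ n) (chordMult_balanced τ hτ n) (ℓ + 2)]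

end SeatingGap

end Summit.KontsevichZagierPeriods.Zeta5Search.Families.Cellular
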